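import Summits.AtomisticToContinuum.Crystallization.Theorems.ChargedEnergyGap.Negative.Unconditional
import HarnessLib

/-!
# `ChargedEnergyGap` (stmt-AtomisticToContinuum-14231), line `two-tolerance-sandwich`:
# a certified negative upper bound on the periodic infimum, `e* ≤ −1/4`

Stub `stub_eStarLe` of the line's skeleton.  The regularisation step of the line deletes
isolated sites and needs a certified NEGATIVE upper bound on
`e* = ⨅_Q e_LJ(Q)` (`ChargedEnergyGapNegative.eStar`); `−1/4` suffices and is what the Bravais
configuration of the unit simple cubic lattice `ℤ³` (`cubicLattice 1`, motif `{0}`) gives when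
only nearest neighbours are counted: the six points `± e_j` lie at the equilibrium distance `1`
(`V_LJ(1) = −1/12`), every other non-zero lattice vector has length `≥ 1` where `V_LJ ≤ 0`
(`lennardJones_nonpos`), and the lattice sum is absolutely summable in `ℝ³`
(`PeriodicConfiguration.summable_lennardJones_dist_three`), so
`e(ℤ³) = ½ · Σ_{v ≠ 0} V_LJ(|v|) ≤ ½ · 6 · (−1/12) = −1/4`, and `e* ≤ e(ℤ³)` by `eStar_le`
(boundedness below of periodic Lennard-Jones energies, item 0714).  All `[folklore]`.
(The sharper `e* ≤ −1/2` via the face-centred cubic lattice is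
`LayeredLawsSelectHcp.Negative.Threshold.eStar_le_neg_half`; this file keeps the line's import
closure inside the `ChargedEnergyGap` negative-side files.)
-/

noncomputable section

namespace Summit.AtomisticToContinuum.Crystallization.Theorems.TwoToleranceSandwichEStar

open Literature.MathematicalPhysics.StatisticalMechanics
open Literature.Barriers.AtomisticToContinuum
  (cubicLattice bravaisConfiguration smul_single_mem_cubicLattice)
open Summit.AtomisticToContinuum.Crystallization.Theorems.ChargedEnergyGapNegative
  (E3 eStar eStar_le le_norm_of_mem_cubicLattice)
open scoped BigOperators

/-! ## The unit cubic lattice `ℤ³` and its Bravais configuration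
`bravaisConfiguration (cubicLattice 1) 0` (motif `{0}`) -/

/-- The generators `e_j` belong to the unit cubic lattice `ℤ³`. [folklore] -/
theorem single_mem_cubicLattice_one (j : Fin 3) :
    EuclideanSpace.single j (1 : ℝ) ∈ cubicLattice 1 := by
  simpa using smul_single_mem_cubicLattice 1 j

/-- Non-zero vectors of `ℤ³` have norm `≥ 1`. [folklore] -/
theorem one_le_norm_of_mem_cubicLattice_one {v : E3} (hv : v ∈ cubicLattice 1) (hv0 : v ≠ 0) :
    1 ≤ ‖v‖ := by
  simpa using le_norm_of_mem_cubicLattice (c := 1) (by simp) hv hv0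

/-- The points of the Bravais configuration of `ℤ³` based at the origin are exactly the lattice
vectors. [folklore] -/
theorem mem_points_cubic_iff {v : E3} :
    v ∈ (bravaisConfiguration (cubicLattice 1) (0 : E3)).points ↔ v ∈ cubicLattice 1 := by
  constructor
  · rintro ⟨y, hy, g, hg, rfl⟩
    have hy0 : y = 0 := Finset.mem_singleton.1 hy
    rw [hy0, zero_add]
    exact hg
  · intro hv
    exact ⟨0, Finset.mem_singleton_self _, v, hv, (zero_add v).symm⟩

/-- Every point of the configuration other than the origin is at distance `≥ 1` from it, so its
Lennard-Jones interaction with the origin is `≤ 0`. [folklore] -/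
theorem lennardJones_dist_nonpos
    (y : {y : E3 // y ∈ (bravaisConfiguration (cubicLattice 1) (0 : E3)).points ∧ y ≠ 0}) :
    lennardJones (dist (0 : E3) y.1) ≤ 0 := by
  apply lennardJones_nonpos
  rw [dist_comm, dist_zero_right]
  exact one_le_norm_of_mem_cubicLattice_one (mem_points_cubic_iff.1 y.2.1) y.2.2

/-- A lattice vector of norm `1` is a point of the configuration other than the origin, and it
contributes `V_LJ(1) = −1/12` to the lattice sum at the origin. [folklore] -/
theorem norm_one_spec {v : E3} (hv : v ∈ cubicLattice 1) (h1 : ‖v‖ = 1) :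
    (v ∈ (bravaisConfiguration (cubicLattice 1) (0 : E3)).points ∧ v ≠ 0) ∧
      lennardJones (dist (0 : E3) v) = -1 / 12 := by
  refine ⟨⟨mem_points_cubic_iff.2 hv, fun h0 => ?_⟩, ?_⟩
  · rw [h0, norm_zero] at h1
    exact zero_ne_one h1
  · rw [dist_comm, dist_zero_right, h1, lennardJones_one]

/-! ## The energy bound -/

/-- **The Lennard-Jones lattice sum of `ℤ³` at the origin is `≤ −1/2`**: split off the six
nearest neighbours `± e_j` (pairwise distinct, each contributing `−1/12`); the summable
remainder is a sum of terms `≤ 0`. [folklore] -/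
theorem tsum_cubic_le :
    ∑' y : {y : E3 // y ∈ (bravaisConfiguration (cubicLattice 1) (0 : E3)).points ∧ y ≠ 0},
        lennardJones (dist (0 : E3) y.1) ≤ -(1 / 2 : ℝ) := by
  classical
  have hsum : Summable
      fun y : {y : E3 //
          y ∈ (bravaisConfiguration (cubicLattice 1) (0 : E3)).points ∧ y ≠ 0} =>
        lennardJones (dist (0 : E3) y.1) :=
    (bravaisConfiguration (cubicLattice 1) (0 : E3)).summable_lennardJones_dist_three 0
  -- the six nearest neighbours `± e_j`: lattice vectors of norm `1`
  have hpos : ∀ j : Fin 3, EuclideanSpace.single j (1 : ℝ) ∈ cubicLattice 1 ∧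
      ‖EuclideanSpace.single j (1 : ℝ)‖ = 1 :=
    fun j => ⟨single_mem_cubicLattice_one j, by simp⟩
  have hneg : ∀ j : Fin 3, -EuclideanSpace.single j (1 : ℝ) ∈ cubicLattice 1 ∧
      ‖-EuclideanSpace.single j (1 : ℝ)‖ = 1 :=
    fun j => ⟨Submodule.neg_mem _ (single_mem_cubicLattice_one j), by simp⟩
  -- ... as elements of the index type
  let emb : Fin 3 ⊕ Fin 3 →
      {y : E3 // y ∈ (bravaisConfiguration (cubicLattice 1) (0 : E3)).points ∧ y ≠ 0} :=
    Sum.elim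
      (fun j => ⟨EuclideanSpace.single j (1 : ℝ), (norm_one_spec (hpos j).1 (hpos j).2).1⟩)
      (fun j => ⟨-EuclideanSpace.single j (1 : ℝ), (norm_one_spec (hneg j).1 (hneg j).2).1⟩)
  have hval : ∀ i, lennardJones (dist (0 : E3) (emb i).1) = -1 / 12 := by
    rintro (j | j)
    · exact (norm_one_spec (hpos j).1 (hpos j).2).2
    · exact (norm_one_spec (hneg j).1 (hneg j).2).2
  -- ... pairwise distinct: the `e_j` form an orthonormal (hence injective) family, and
  -- `e_j ≠ -e_k` by comparing `j`-th coordinates (`1` versus `-1` or `0`)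
  have hv : Function.Injective fun j : Fin 3 => EuclideanSpace.single j (1 : ℝ) :=
    EuclideanSpace.orthonormal_single.linearIndependent.injective
  have hmix : ∀ j k : Fin 3,
      EuclideanSpace.single j (1 : ℝ) ≠ -EuclideanSpace.single k (1 : ℝ) := by
    intro j k h
    have h1 := congrArg (fun v : E3 => v j) h
    simp only [PiLp.neg_apply, PiLp.single_apply] at h1
    split_ifs at h1 <;> norm_num at h1
  have hinj : Function.Injective emb := by
    rintro (j | j) (k | k) h
    · have h' : EuclideanSpace.single j (1 : ℝ) = EuclideanSpace.single k (1 : ℝ) :=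
        congrArg Subtype.val h
      exact congrArg Sum.inl (hv h')
    · have h' : EuclideanSpace.single j (1 : ℝ) = -EuclideanSpace.single k (1 : ℝ) :=
        congrArg Subtype.val h
      exact absurd h' (hmix j k)
    · have h' : -EuclideanSpace.single j (1 : ℝ) = EuclideanSpace.single k (1 : ℝ) :=
        congrArg Subtype.val h
      exact absurd h'.symm (hmix k j)
    · have h' : -EuclideanSpace.single j (1 : ℝ) = -EuclideanSpace.single k (1 : ℝ) :=
        congrArg Subtype.val h
      exact congrArg Sum.inr (hv (neg_injective h'))
  -- their contribution `6 · (−1/12) = −1/2`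
  have hS : ∑ y ∈ Finset.univ.image emb, lennardJones (dist (0 : E3) y.1) = -(1 / 2 : ℝ) := by
    rw [Finset.sum_image fun i _ k _ h => hinj h, Finset.sum_congr rfl fun i _ => hval i,
      Finset.sum_const, Finset.card_univ, Fintype.card_sum, Fintype.card_fin, nsmul_eq_mul]
    norm_num
  -- the remainder is `≤ 0`
  have hsplit := hsum.sum_add_tsum_compl (s := Finset.univ.image emb)
  have htail : ∑' y : ↥((↑(Finset.univ.image emb) :
      Set {y : E3 // y ∈ (bravaisConfiguration (cubicLattice 1) (0 : E3)).points ∧ y ≠ 0})ᶜ),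
        lennardJones (dist (0 : E3) y.1.1) ≤ 0 :=
    tsum_nonpos fun y => lennardJones_dist_nonpos y.1
  rw [← hsplit, hS]
  linarith

/-- **`e(ℤ³) ≤ −1/4`** for the Bravais configuration of the unit cubic lattice: its motif is the
single point `0`, so `e = ½ ·` (lattice sum at the origin) `≤ ½ · (−1/2)`. [folklore] -/
theorem energyPerParticle_cubic_le :
    (bravaisConfiguration (cubicLattice 1) (0 : E3)).energyPerParticle lennardJones ≤
      -(1 / 4 : ℝ) := by
  have hE : (bravaisConfiguration (cubicLattice 1) (0 : E3)).energyPerParticle lennardJones =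
      2⁻¹ * ∑' y : {y : E3 //
        y ∈ (bravaisConfiguration (cubicLattice 1) (0 : E3)).points ∧ y ≠ 0},
          lennardJones (dist (0 : E3) y.1) := by
    unfold PeriodicConfiguration.energyPerParticle
    rw [show (bravaisConfiguration (cubicLattice 1) (0 : E3)).motif = {0} from rfl,
      Finset.sum_singleton, Finset.card_singleton]
    norm_num
  rw [hE]
  linarith [tsum_cubic_le]

/-- **`e* ≤ −1/4`**: the periodic infimum of the Lennard-Jones energy per particle in `ℝ³` is
at most the energy per particle of the unit cubic lattice (`eStar_le`, item 0714), which is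
`≤ −1/4`. In particular `e* < 0`. [folklore] -/
theorem stub_eStarLe :
    Summit.AtomisticToContinuum.Crystallization.Theorems.ChargedEnergyGapNegative.eStar ≤
      -(1 / 4 : ℝ) :=
  (eStar_le _).trans energyPerParticle_cubic_le

end Summit.AtomisticToContinuum.Crystallization.Theorems.TwoToleranceSandwichEStar

end
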